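import Literature.NumberTheory.EllipticCurves.TowerTorsionCutPresentedProofs
import Literature.NumberTheory.EllipticCurves.TowerEndomorphismKernelLiftProofs
import HarnessLib

/-!
# The three cohomological inputs (hTor), (hF2), (hLift) of the torsion-cut readout of a saturated condition,
# for a presented tower with `R`-scalars — from `H⁰`- and `H²`-annihilation by a power of the uniformiser (theorems only)

`Proofs` file (theorems only; no definition, no named fact, no instance, no `sorry`).  Topic `NumberTheory/EllipticCurves`
(D1 road of cell `pub/bsd-print-x9`, Howard's H.5(b) for the Eisenstein specialisation at the places `v ∣ p`, the UNIFORM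
«`ι` on the characteristic-`p` level» road of `x9-p1-w3`, brick (F1b-INST), generic layer).  Companion of
`TowerTorsionCutPresentedProofs` (F2: `Tower.map_levelCondition_eq_map_comap_strict`, Howard's propagated condition read
inside one level by the torsion cut `{y | π^r • y ∈ H¹_str}`), which keeps exactly three `H¹`-hypotheses — (hTor), (hF2),
(hLift) — and of `TowerEndomorphismKernelLiftProofs` (the `δ₀`/`δ₁` dischargers (T1)–(T3∞)).  Here the three hypotheses are
DERIVED, in F2's literal binder shapes (same presented-tower currency `ρ`/`f`/`π`/`Fil`/`hΓ`, same binders `q hq`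
(the quotient family) and `πq hπq` (the quotient scalar endomorphisms)), from the module-level annihilation statements
that hold on Howard's `π`-adic Eisenstein tower at a place `v ∣ p` (`ZpExtensionEisensteinPiLevelInvariantsBoundProofs`):

* §1 **(hTor)** `quot_map_quotPow_eq_zero_of_forall_pow_smul_eq_zero`: if `πq d r` kills the `Γ_F`-invariants of every
  graded level `W d ⧸ Fil d` (`hinv`: «`π^r · H⁰(gr_d) = 0`», uniformly in `d`) and `(π^m + p) · W = 0`, then for every family `w`
  of `H¹(F, gr_j)` compatible under the reductions and killed levelwise by `p^a`, `H¹(πq j r) (w j) = 0` for all `j` —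
  `p^a = ±π^{ma} = ` (up ∘ down) on the quotient tower, so `w j ∈ ker H¹(q j (j + ma)) = δ₀ H⁰(gr_{ma})`, killed by `H¹(πq j r)`
  by (T1) (naturality of `δ₀`);
* §2 **(hF2)** `exists_quotientMap_eq_map_quotPow_of_map_two_eq_zero`: if an equivariant endomorphism `t j` of the plus part
  `Fil j` acting as `π^c` kills `H²(F, Fil j)` (`hH2Fil`), then `H¹(πq j c) w` lifts along `H¹(W j) → H¹(W j ⧸ Fil j)` for every
  `w` — (T4) on `0 → Fil j → W j → W j ⧸ Fil j → 0` (naturality of `δ₁`); with `exists_subPowFamily_apply` (such `t` exist when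
  `Fil` is `R`-stable);
* §3 **(hLift)** `exists_mem_compatibleFamilies_map_eq_map_of_scalarMap_two_eq_zero` (and the `N - c'` form `…_map_sub_eq_…`
  that F2 consumes): if `H²(π^{c'} •) = 0` on every `H²(F, W j)` (`hH2`, `galoisCohomology.scalarMap … 2`), then for every
  `y ∈ H¹(F, W N)` there is a COMPATIBLE family `x` with `H¹(f N (N − c')) (x N) = H¹(f N (N − c')) y` — (T3∞) gives a
  compatible family through `π^{c'} • y = H¹(f (N−c') N)(H¹(f N (N−c')) y)`, and liftability (L)
  (`exists_mem_compatibleFamilies_apply_eq_of_map_eq`) moves it to `H¹(f N (N − c')) y`.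

The instance at `v ∣ p` (the curve's `π`-adic refinement datum, `piFil`) is `ZpExtensionEisensteinPiTorsionCutInputsProofs`.

References: B. Howard, Compositio Math. 140 (2004), §1.3 H.5(b), Def. 1.1.3, §1.6, §3.1, Lemma 3.2.7 (arXiv:1202.6340 p. 5,
p. 7 L96–97, p. 12 L29–55, p. 15–16); Mazur–Rubin (2004), Lemma 3.7.1; Serre, *Galois Cohomology* (1997), I §2.2–2.3;
Neukirch–Schmidt–Wingberg (2008), (1.3.2)–(1.3.3).  No summit statement is proved; BSD is not proved by any of this.
-/

set_option autoImplicit false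

noncomputable section

open CategoryTheory
open scoped ContRepresentation

namespace Literature.NumberTheory.EllipticCurves

namespace Tower

open Literature.NumberTheory.GaloisRepresentations
open Literature.NumberTheory.GaloisRepresentations.DiscreteGaloisModule

variable {F : Type} [Field F] {R : Type} [CommRing R]
variable {W : ℕ → Type} [∀ j, AddCommGroup (W j)] [∀ j, Module R (W j)] [∀ j, TopologicalSpace (W j)]
  [∀ j, DiscreteTopology (W j)]
variable {ρ : ∀ j, DiscreteGaloisModule F (W j)} (hlin : ∀ j, (ρ j).IsScalarLinear R)
variable {f : ∀ a b, (ρ a).toContRepresentation →ⁱL (ρ b).toContRepresentation}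
variable {π : R} {Fil : ∀ j, Submodule ℤ (W j)}
variable {hΓ : ∀ j (σ : Field.absoluteGaloisGroup F), Fil j ≤ (Fil j).comap (ρ j σ)}
variable {q : ∀ a b, ((ρ a).quotient (Fil a) (hΓ a)).toContRepresentation →ⁱL
    ((ρ b).quotient (Fil b) (hΓ b)).toContRepresentation}
  (hq : ∀ a b (x : W a), q a b (Submodule.Quotient.mk x) = Submodule.Quotient.mk (f a b x))
  {πq : ∀ j (n : ℕ), ((ρ j).quotient (Fil j) (hΓ j)).toContRepresentation →ⁱL
    ((ρ j).quotient (Fil j) (hΓ j)).toContRepresentation}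
  (hπq : ∀ j n (x : W j), πq j n (Submodule.Quotient.mk x) = Submodule.Quotient.mk (π ^ n • x))

/-! ## §0 Endomorphisms acting as an integer: powers -/

/-- If an additive endomorphism acts as the integer `n`, its `k`-th power acts as `n^k` (the `S_𝔮`-scalars `π^m = −p` acting on
cohomology). [cite: Howard2004HeegnerKolyvagin, §2.2 (T_𝔮 is an S_𝔮[G_K]-module; arXiv p. 12)] -/
theorem endPow_apply_eq_zsmul_pow {A : Type} [AddCommGroup A] (e : AddMonoid.End A) (n : ℤ)
    (h : ∀ x, e x = n • x) (k : ℕ) (x : A) : (e ^ k) x = n ^ k • x := by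
  induction k generalizing x with
  | zero => rw [pow_zero, pow_zero, AddMonoid.End.one_apply, one_smul]
  | succ k ih => rw [endPow_succ_apply', ih, h, smul_smul, ← pow_succ']

/-! ## §1 (hTor): families killed by `p^a` are killed by `H¹(πq j r)` -/

include hq hπq in
/-- **(hTor)** — the first `H¹`-hypothesis of `Tower.map_levelCondition_eq_map_comap_strict`, from «`πq d r` kills the
`Γ_F`-invariants of `W d ⧸ Fil d` for every `d`» (`hinv`) and `(π^m + p) · W = 0` (`hqm`).  For a family `w` of classes of
the graded levels compatible under the reductions `H¹(q (j+1) j)` with `p^a • w j = 0` for all `j`: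
`w j = H¹(q (j + ma) j) (w (j + ma))`, so `H¹(q j (j + ma)) (w j) = H¹(πq (j+ma) (ma)) (w (j + ma)) = (−p)^a • w (j + ma) = 0`
(`map_quot_up_down`, `map_quotPow_one_pow`, `quotPow_apply_eq_neg_zsmul`); then (T1) `Tower.map_endo_eq_zero_of_map_up_eq_zero`
on the quotient tower (identities `quotFamily_injective/_surjective/_exact`, commuting endomorphisms `πq · r` by
`quot_apply_quotPow`) with `hinv` at the level `ma`.
[cite: Howard2004HeegnerKolyvagin, §1.3 H.5(b), §1.6 and Lemma 3.2.7 (arXiv p. 7 L96–97, p. 12 L29–55, p. 16)]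
[cite: SerreGaloisCohomology1997, Ch. I §2.2] -/
theorem quot_map_quotPow_eq_zero_of_forall_pow_smul_eq_zero
    (hfR : ∀ a b (r : R) (x : W a), f a b (r • x) = r • f a b x)
    (hid : ∀ a (w : W a), f a a w = w)
    (hcomp : ∀ a b c, c ≤ b → b ≤ a → ∀ w : W a, f b c (f a b w) = f a c w)
    (hsurj : ∀ ℓ n, Function.Surjective (f (ℓ + n) n))
    (hex : ∀ ℓ n (y : W (ℓ + n)), f (ℓ + n) n y = 0 ↔ ∃ x, f ℓ (ℓ + n) x = y)
    (hpow : ∀ ℓ n (x : W (ℓ + n)), f ℓ (ℓ + n) (f (ℓ + n) ℓ x) = π ^ n • x)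
    (hmapF : ∀ a b, ∀ w ∈ Fil a, f a b w ∈ Fil b)
    (hontoF : ∀ ℓ n, ∀ w' ∈ Fil n, ∃ w ∈ Fil (ℓ + n), f (ℓ + n) n w = w')
    (hsatF : ∀ ℓ n (w : W ℓ), f ℓ (ℓ + n) w ∈ Fil (ℓ + n) → w ∈ Fil ℓ)
    (p : ℕ) {m : ℕ} (hqm : ∀ j (x : W j), π ^ m • x + (p : ℤ) • x = 0) (r : ℕ)
    (hinv : ∀ d (y : W d ⧸ Fil d),
      (∀ σ : Field.absoluteGaloisGroup F, (ρ d).quotient (Fil d) (hΓ d) σ y = y) → πq d r y = 0)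
    {w : Π j, galoisCohomology ((ρ j).quotient (Fil j) (hΓ j)) 1}
    (hw : w ∈ compatibleFamilies (H := fun j ↦ galoisCohomology ((ρ j).quotient (Fil j) (hΓ j)) 1)
      (fun j ↦ galoisCohomology.map (q (j + 1) j) 1))
    (a : ℕ) (ha : ∀ j, p ^ a • w j = 0) (j : ℕ) :
    galoisCohomology.map (πq j r) 1 (w j) = 0 := by
  -- `H¹(q j (j + m a)) (w j) = 0`
  have hup : galoisCohomology.map (q j (j + m * a)) 1 (w j) = 0 := by
    have hwj : w j = galoisCohomology.map (q (j + m * a) j) 1 (w (j + m * a)) :=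
      (map_apply_eq_of_mem (fun j ↦ (ρ j).quotient (Fil j) (hΓ j)) q (quotFamily_id hq hid)
        (quotFamily_comp hq hcomp) hw (Nat.le_add_right j (m * a))).symm
    rw [hwj, map_quot_up_down hq hπq hpow j (m * a), ← map_quotPow_one_pow hπq, pow_mul]
    -- `(H¹(πq · 1))^m = H¹(πq · m)` acts as `-p`
    have hneg : ∀ x : galoisCohomology ((ρ (j + m * a)).quotient (Fil (j + m * a)) (hΓ (j + m * a))) 1,
        ((@id (AddMonoid.End _) (galoisCohomology.map (πq (j + m * a) 1) 1)) ^ m) x = (-(p : ℤ)) • x := fun x ↦ by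
      rw [map_quotPow_one_pow hπq]
      exact map_eq_zsmul_of_forall_apply_eq (πq (j + m * a) m) (-(p : ℤ))
        (quotPow_apply_eq_neg_zsmul hπq p hqm (j + m * a)) x
    rw [endPow_apply_eq_zsmul_pow _ (-(p : ℤ)) hneg a, neg_pow, mul_smul, ← Nat.cast_pow, natCast_zsmul,
      ha (j + m * a), smul_zero]
  -- (T1) on the quotient tower with the endomorphisms `πq · r`
  exact map_endo_eq_zero_of_map_up_eq_zero (fun j ↦ (ρ j).quotient (Fil j) (hΓ j)) q
    (quotFamily_injective hq hsatF) (quotFamily_surjective hq hsurj) (quotFamily_exact hq hmapF hex hontoF)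
    (fun j ↦ πq j r) (fun a b x ↦ quot_apply_quotPow hq hπq hfR a b r x) j (m * a)
    (fun x hx ↦ hinv (m * a) x fun σ ↦ hx σ) (w j) hup

include hq hπq in
/-- **(hTor) in F2's literal binder shape** (`∀ w ∈ compatibleFamilies …, ∀ a, (∀ j, p ^ a • w j = 0) → ∀ j, …`).
[cite: Howard2004HeegnerKolyvagin, §1.3 H.5(b), §1.6 and Lemma 3.2.7] [cite: SerreGaloisCohomology1997, Ch. I §2.2] -/
theorem forall_quot_map_quotPow_eq_zero_of_forall_pow_smul_eq_zero
    (hfR : ∀ a b (r : R) (x : W a), f a b (r • x) = r • f a b x)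
    (hid : ∀ a (w : W a), f a a w = w)
    (hcomp : ∀ a b c, c ≤ b → b ≤ a → ∀ w : W a, f b c (f a b w) = f a c w)
    (hsurj : ∀ ℓ n, Function.Surjective (f (ℓ + n) n))
    (hex : ∀ ℓ n (y : W (ℓ + n)), f (ℓ + n) n y = 0 ↔ ∃ x, f ℓ (ℓ + n) x = y)
    (hpow : ∀ ℓ n (x : W (ℓ + n)), f ℓ (ℓ + n) (f (ℓ + n) ℓ x) = π ^ n • x)
    (hmapF : ∀ a b, ∀ w ∈ Fil a, f a b w ∈ Fil b)
    (hontoF : ∀ ℓ n, ∀ w' ∈ Fil n, ∃ w ∈ Fil (ℓ + n), f (ℓ + n) n w = w')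
    (hsatF : ∀ ℓ n (w : W ℓ), f ℓ (ℓ + n) w ∈ Fil (ℓ + n) → w ∈ Fil ℓ)
    (p : ℕ) {m : ℕ} (hqm : ∀ j (x : W j), π ^ m • x + (p : ℤ) • x = 0) (r : ℕ)
    (hinv : ∀ d (y : W d ⧸ Fil d),
      (∀ σ : Field.absoluteGaloisGroup F, (ρ d).quotient (Fil d) (hΓ d) σ y = y) → πq d r y = 0) :
    ∀ w ∈ compatibleFamilies (H := fun j ↦ galoisCohomology ((ρ j).quotient (Fil j) (hΓ j)) 1)
        (fun j ↦ galoisCohomology.map (q (j + 1) j) 1),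
      ∀ a : ℕ, (∀ j, p ^ a • w j = 0) → ∀ j, galoisCohomology.map (πq j r) 1 (w j) = 0 :=
  fun _ hw a ha j ↦ quot_map_quotPow_eq_zero_of_forall_pow_smul_eq_zero hq hπq hfR hid hcomp hsurj hex hpow hmapF hontoF
    hsatF p hqm r hinv hw a ha j

/-! ## §2 (hF2): `H¹(πq j c) w` lifts to `H¹(F, W j)` when `π^c` kills `H²(F, Fil j)` -/

include hlin in
/-- **The scalar endomorphisms `π^c •` of the plus parts exist** (as continuous equivariant endomorphisms of the
subrepresentations) when the `Fil j` are `R`-stable. [cite: Howard2004HeegnerKolyvagin, Def. 1.1.1 and §3.1 (arXiv p. 5 L20–21, p. 15: Fil_v T_𝔮 an S_𝔮-submodule)] -/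
theorem exists_subPowFamily_apply (hFilR : ∀ j (r : R) (x : W j), x ∈ Fil j → r • x ∈ Fil j) (c : ℕ) :
    ∃ t : ∀ j, ((ρ j).subrepresentation (Fil j) (hΓ j)).toContRepresentation →ⁱL
        ((ρ j).subrepresentation (Fil j) (hΓ j)).toContRepresentation,
      ∀ j (x : Fil j), ((t j x : Fil j) : W j) = π ^ c • (x : W j) := by
  refine ⟨fun j ↦
    { toContinuousLinearMap :=
        ⟨(scalarIntertwining (ρ j) (hlin j) (π ^ c)).toContinuousLinearMap.toLinearMap.restrict
            fun w hw ↦ hFilR j (π ^ c) w hw,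
          continuous_of_discreteTopology⟩
      isIntertwining' := fun σ ↦ ContinuousLinearMap.ext fun x ↦
        Subtype.ext ((scalarIntertwining (ρ j) (hlin j) (π ^ c)).isIntertwining σ (x : W j)) },
    fun j x ↦ rfl⟩

include hlin hπq in
/-- **(hF2)** — the second `H¹`-hypothesis of `Tower.map_levelCondition_eq_map_comap_strict`: if an equivariant endomorphism
`t j` of `Fil j` acting as `π^c` kills `H²(F, Fil j)` (`hH2Fil`), then for every `w ∈ H¹(F, W j ⧸ Fil j)` the class `H¹(πq j c) w`
is the image of a class of `H¹(F, W j)` — `(t j, π^c •, πq j c)` is an endomorphism of `0 → Fil j → W j → W j ⧸ Fil j → 0`, and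
`δ₁ (H¹(πq j c) w) = H²(t j)(δ₁ w) = 0` (`Tower.exists_cohomologyMap_one_eq_of_cohomologyMap_two_eq_zero`).
[cite: Howard2004HeegnerKolyvagin, §1.3 H.5(b) and §3.1 (arXiv p. 7 L96–97, p. 15)] [cite: SerreGaloisCohomology1997, Ch. I §2.2–2.3] -/
theorem exists_quotientMap_eq_map_quotPow_of_map_two_eq_zero
    (t : ∀ j, ((ρ j).subrepresentation (Fil j) (hΓ j)).toContRepresentation →ⁱL
      ((ρ j).subrepresentation (Fil j) (hΓ j)).toContRepresentation)
    (c : ℕ) (ht : ∀ j (x : Fil j), ((t j x : Fil j) : W j) = π ^ c • (x : W j))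
    (hH2Fil : ∀ j (z : galoisCohomology ((ρ j).subrepresentation (Fil j) (hΓ j)) 2),
      galoisCohomology.map (t j) 2 z = 0)
    (j : ℕ) (w : galoisCohomology ((ρ j).quotient (Fil j) (hΓ j)) 1) :
    ∃ z : galoisCohomology (ρ j) 1,
      (ρ j).quotientMap (Fil j) (hΓ j) 1 z = galoisCohomology.map (πq j c) 1 w := by
  haveI : CompactSpace (Field.absoluteGaloisGroup F) := absoluteGaloisGroup_compactSpace F
  obtain ⟨z, hz⟩ := exists_cohomologyMap_one_eq_of_cohomologyMap_two_eq_zero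
    (isSES_subtype_mkQ (ρ j) (Fil j) (hΓ j))
    (φ₁ := TopRep.ofHom ⟨(t j).toContinuousLinearMap, (t j).isIntertwining'⟩)
    (φ₂ := TopRep.ofHom ⟨(scalarIntertwining (ρ j) (hlin j) (π ^ c)).toContinuousLinearMap,
      (scalarIntertwining (ρ j) (hlin j) (π ^ c)).isIntertwining'⟩)
    (φ₃ := TopRep.ofHom ⟨(πq j c).toContinuousLinearMap, (πq j c).isIntertwining'⟩)
    (fun x ↦ (ht j x).symm) (fun y ↦ hπq j c y)
    (fun z ↦ by rw [← map_two_eq_cohomologyMap_apply]; exact hH2Fil j z) w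
  exact ⟨z, by rw [galoisCohomology.map_eq_cohomologyMap_apply]; exact hz⟩

/-! ## §3 (hLift): compatible families through `H¹(f N (N − c')) y` when `π^{c'}` kills `H²(F, W j)` -/

include hlin in
/-- **(hLift), `i + c'` form.**  If `H²(π^{c'} •) = 0` on every `H²(F, W j)` (`hH2`), then for every `y ∈ H¹(F, W (i + c'))`
there is a compatible family `x` of `lim_j H¹(F, W_j)` with `H¹(f (i+c') i) (x (i + c')) = H¹(f (i+c') i) y`: by (T3∞)
(`Tower.exists_mem_compatibleFamilies_apply_eq_scalarMapH1`) `π^{c'} • y` is the `(i+c')`-component of a compatible family,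
and `π^{c'} • y = H¹(f i (i+c')) (H¹(f (i+c') i) y)` (`hpow`), so liftability (L)
(`Tower.exists_mem_compatibleFamilies_apply_eq_of_map_eq`) makes `H¹(f (i+c') i) y` the `i`-component of a compatible family.
[cite: Howard2004HeegnerKolyvagin, §1.3 H.5(b), §1.6 and Lemma 3.2.7 (arXiv p. 7 L96–97, p. 12, p. 16)]
[cite: SerreGaloisCohomology1997, Ch. I §2.2–2.3] -/
theorem exists_mem_compatibleFamilies_map_eq_map_of_scalarMap_two_eq_zero
    [∀ j, Finite (galoisCohomology (ρ j) 1)]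
    (hfR : ∀ a b (r : R) (x : W a), f a b (r • x) = r • f a b x)
    (hid : ∀ a (w : W a), f a a w = w)
    (hcomp : ∀ a b c, c ≤ b → b ≤ a → ∀ w : W a, f b c (f a b w) = f a c w)
    (hsq : ∀ a b, a ≤ b → ∀ w : W (a + 1), f a b (f (a + 1) a w) = f (b + 1) b (f (a + 1) (b + 1) w))
    (hinj : ∀ ℓ n, Function.Injective (f ℓ (ℓ + n)))
    (hsurj : ∀ ℓ n, Function.Surjective (f (ℓ + n) n))
    (hex : ∀ ℓ n (y : W (ℓ + n)), f (ℓ + n) n y = 0 ↔ ∃ x, f ℓ (ℓ + n) x = y)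
    (hpow : ∀ ℓ n (x : W (ℓ + n)), f ℓ (ℓ + n) (f (ℓ + n) ℓ x) = π ^ n • x)
    (c' : ℕ) (hH2 : ∀ j (z : galoisCohomology (ρ j) 2), galoisCohomology.scalarMap (ρ j) (hlin j) 2 (π ^ c') z = 0)
    (i : ℕ) (y : galoisCohomology (ρ (i + c')) 1) :
    ∃ x ∈ compatibleFamilies (H := fun j ↦ galoisCohomology (ρ j) 1) (fun j ↦ galoisCohomology.map (f (j + 1) j) 1),
      galoisCohomology.map (f (i + c') i) 1 (x (i + c')) = galoisCohomology.map (f (i + c') i) 1 y := by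
  -- (T3∞): `π^{c'} • y` is the `(i+c')`-component of a compatible family
  obtain ⟨x₀, hx₀, hx₀N⟩ := exists_mem_compatibleFamilies_apply_eq_scalarMapH1 ρ f hlin hid hcomp hinj hsurj hex (π ^ c')
    (fun a b x ↦ hfR a b _ x) hH2 (i + c') y
  -- `H¹(f i (i+c')) (H¹(f (i+c') i) y) = π^{c'} • y`
  have hy' : galoisCohomology.map (f i (i + c')) 1 (galoisCohomology.map (f (i + c') i) 1 y) = x₀ (i + c') := by
    rw [hx₀N, galoisCohomology.map_map_of_comp_apply (f (i + c') i) (f i (i + c'))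
      (scalarIntertwining (ρ (i + c')) (hlin (i + c')) (π ^ c'))
      (fun x ↦ by rw [scalarIntertwining_apply]; exact (hpow i c' x).symm)]
    rfl
  -- (L): `H¹(f (i+c') i) y` is the `i`-component of a compatible family
  obtain ⟨z, hz, hzi⟩ := exists_mem_compatibleFamilies_apply_eq_of_map_eq ρ f hid hcomp hsq hinj hsurj hex i c'
    (galoisCohomology.map (f (i + c') i) 1 y) ⟨x₀, hx₀, hy'⟩
  exact ⟨z, hz, by rw [map_apply_eq_of_mem ρ f hid hcomp hz (Nat.le_add_right i c'), hzi]⟩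

include hlin in
/-- **(hLift), free-index form**: for `i ≤ N`, if `H²(π^{N−i} •) = 0` on every `H²(F, W j)`, every `y ∈ H¹(F, W N)` agrees
at level `i` with a compatible family. [cite: Howard2004HeegnerKolyvagin, §1.6 and Lemma 3.2.7] [cite: SerreGaloisCohomology1997, Ch. I §2.2–2.3] -/
theorem exists_mem_compatibleFamilies_map_eq_map_of_le
    [∀ j, Finite (galoisCohomology (ρ j) 1)]
    (hfR : ∀ a b (r : R) (x : W a), f a b (r • x) = r • f a b x)
    (hid : ∀ a (w : W a), f a a w = w)
    (hcomp : ∀ a b c, c ≤ b → b ≤ a → ∀ w : W a, f b c (f a b w) = f a c w)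
    (hsq : ∀ a b, a ≤ b → ∀ w : W (a + 1), f a b (f (a + 1) a w) = f (b + 1) b (f (a + 1) (b + 1) w))
    (hinj : ∀ ℓ n, Function.Injective (f ℓ (ℓ + n)))
    (hsurj : ∀ ℓ n, Function.Surjective (f (ℓ + n) n))
    (hex : ∀ ℓ n (y : W (ℓ + n)), f (ℓ + n) n y = 0 ↔ ∃ x, f ℓ (ℓ + n) x = y)
    (hpow : ∀ ℓ n (x : W (ℓ + n)), f ℓ (ℓ + n) (f (ℓ + n) ℓ x) = π ^ n • x)
    {i N : ℕ} (hiN : i ≤ N)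
    (hH2 : ∀ j (z : galoisCohomology (ρ j) 2), galoisCohomology.scalarMap (ρ j) (hlin j) 2 (π ^ (N - i)) z = 0)
    (y : galoisCohomology (ρ N) 1) :
    ∃ x ∈ compatibleFamilies (H := fun j ↦ galoisCohomology (ρ j) 1) (fun j ↦ galoisCohomology.map (f (j + 1) j) 1),
      galoisCohomology.map (f N i) 1 (x N) = galoisCohomology.map (f N i) 1 y := by
  obtain ⟨c', rfl⟩ := Nat.exists_eq_add_of_le hiN
  rw [Nat.add_sub_cancel_left] at hH2
  exact exists_mem_compatibleFamilies_map_eq_map_of_scalarMap_two_eq_zero hlin hfR hid hcomp hsq hinj hsurj hex hpow c'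
    hH2 i y

include hlin in
/-- **(hLift) in F2's literal binder shape** — the third `H¹`-hypothesis of `Tower.map_levelCondition_eq_map_comap_strict`
(`H¹(f N (N − c'))`, `c' ≤ N`). [cite: Howard2004HeegnerKolyvagin, §1.3 H.5(b), §1.6 and Lemma 3.2.7 (arXiv p. 7, p. 12, p. 16)]
[cite: SerreGaloisCohomology1997, Ch. I §2.2–2.3] -/
theorem exists_mem_compatibleFamilies_map_sub_eq_map_sub_of_scalarMap_two_eq_zero
    [∀ j, Finite (galoisCohomology (ρ j) 1)]
    (hfR : ∀ a b (r : R) (x : W a), f a b (r • x) = r • f a b x)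
    (hid : ∀ a (w : W a), f a a w = w)
    (hcomp : ∀ a b c, c ≤ b → b ≤ a → ∀ w : W a, f b c (f a b w) = f a c w)
    (hsq : ∀ a b, a ≤ b → ∀ w : W (a + 1), f a b (f (a + 1) a w) = f (b + 1) b (f (a + 1) (b + 1) w))
    (hinj : ∀ ℓ n, Function.Injective (f ℓ (ℓ + n)))
    (hsurj : ∀ ℓ n, Function.Surjective (f (ℓ + n) n))
    (hex : ∀ ℓ n (y : W (ℓ + n)), f (ℓ + n) n y = 0 ↔ ∃ x, f ℓ (ℓ + n) x = y)
    (hpow : ∀ ℓ n (x : W (ℓ + n)), f ℓ (ℓ + n) (f (ℓ + n) ℓ x) = π ^ n • x)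
    {c' N : ℕ} (hc' : c' ≤ N)
    (hH2 : ∀ j (z : galoisCohomology (ρ j) 2), galoisCohomology.scalarMap (ρ j) (hlin j) 2 (π ^ c') z = 0)
    (y : galoisCohomology (ρ N) 1) :
    ∃ x ∈ compatibleFamilies (H := fun j ↦ galoisCohomology (ρ j) 1) (fun j ↦ galoisCohomology.map (f (j + 1) j) 1),
      galoisCohomology.map (f N (N - c')) 1 (x N) = galoisCohomology.map (f N (N - c')) 1 y :=
  exists_mem_compatibleFamilies_map_eq_map_of_le hlin hfR hid hcomp hsq hinj hsurj hex hpow (Nat.sub_le N c')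
    (by rw [Nat.sub_sub_self hc']; exact hH2) y

end Tower

end Literature.NumberTheory.EllipticCurves

end
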